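/-
Copyright (c) 2026 the pub-hodgecm-mathlib formalisation cell (harness21).  Prover seat hodgecm-mathlib-K2E2-p13 (g3), HCML Track B «K2-LIT» (build stream 29),
h413 = `stmt-HodgeConjecture-24833`, line `K2_E3_EllipticInputs`, unit U12 «Characters», socket #11 road (11-SC), letter (SC-an), road «FC» (finite conjugation
measure), brick (FC-5c) «STEP (v) UNCONDITIONAL» = ★ (FC-5b) p857248 ∘ ★ (FC-D) p857254 ((SC-an) lead K2E3-p14 (g4) RULINGS #15 (R15-1)(v) ∕ #19; `K2/STATUS.md` 2026-09-04T04:09Z).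
-/
import Summits.HodgeConjecture.HodgeConjecture.Theorems.K2E3TorusOneAveraging   -- ★ (FC-5b) p857248 (this seat): `measure_inter_nearCollision_le_of_unitsDigitFibre'` (step (v) over the hypothesis `hD`)
import Summits.HodgeConjecture.HodgeConjecture.Theorems.K2E3UnitsDigitFibre     -- ★ (FC-D) p857254 (K2E3-p21 (g4)): `unitsDigitFibre` (the two fibre bounds = `hD`), `continuous_of_normAbs_eq` (`hσn ⇒` `σ` continuous)
import HarnessLib

/-!
# h413 ∕ Track B «K2-LIT», (SC-an) line, road «FC» — brick (FC-5c): STEP (v) UNCONDITIONAL, «`μ(B ∩ {near-collision at scale ε}) ≤ C·(ε∕ρ)^κ·μ(B)`»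
# (Harish-Chandra 1970, Part VII §2 p. 69; Rogawski 1990, §1.10 p. 9)

Cell `pub/hodgecm-mathlib`, Track B «K2-LIT», crux H413 = `stmt-HodgeConjecture-24833` (lane `--supports … --as helper`, count-neutral).  THEOREMS ONLY (no `def`,
no `instance`, no `notation`, no named-fact hypothesis, no `sorry`).

WHAT.  ★ (FC-5b) `K2E3TorusOneAveraging.measure_inter_nearCollision_le_of_unitsDigitFibre'` is step (R15-1)(v) of road «FC» CONDITIONAL on the conclusion `hD` of (FC-D);
★ (FC-D) `K2E3UnitsDigitFibre.unitsDigitFibre` (K2E3-p21 (g4), head = K2E3-p20 (g4)'s frozen bytes verbatim) now supplies `hD`, its `continuous_of_normAbs_eq` supplies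
`hσc`, and ★ `TateLocalFactorsProofs.isOpen_units_valuation_eq_one` ∕ `isCompact_units_valuation_eq_one` supply `0 < μ'(𝒪^×) < ⊤` for any Haar measure `μ'` of `Kˣ`
(in the binder-style `[MeasurableSpace Kˣ] [BorelSpace Kˣ]` currency of (FC-D), either instance convention docking).  THIS FILE is the
one-name DISCHARGE for the (FC-8) assembly `K2E3FinConjRankOne` F3 (K2E3-p23 (g4)): **`measure_inter_nearCollision_le`** — for `K` a non-archimedean local field of
characteristic zero, `σ` an isometric involution, `μ'` a Haar measure on `Kˣ`, `μ` a left-invariant `SFinite` measure on `U = U(σ, Φ₃)(K)`: `∃ κ > 0, ∃ C ≠ ⊤, ∀ ρ > 0, ∀ ε,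
∀ B ⊆ U` measurable with `t_a • B = B` for `a ∈ 𝒪^×` and `ρ ≤ |g₀₀|, |g₁₁|` on `B`: `μ(B ∩ {g | ∃ i ≠ j, |g_ii − g_jj| ≤ ε}) ≤ C · (ε∕ρ)^κ · μ(B)`
(`t_a = diag(a, 1, σ(a)⁻¹)`; `κ = log p ∕ log|p|_K⁻¹`, `C = 3·max(C_D, 1)` from (FC-D) ∕ (FC-5)); plus the un-cancelled twin `unitSphere_mul_measure_inter_nearCollision_le`
(no Haar hypothesis on `μ'` beyond `SFinite` + Borel: `μ'(𝒪^×)·μ(B ∩ …) ≤ C·(ε∕ρ)^κ·μ'(𝒪^×)·μ(B)` needs `IsHaarMeasure` only through (FC-D)).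

HONEST LABEL: HC_CM is proved only modulo the 7 printed citations (2 remaining named inputs: hLiu418 = `stmt-HodgeConjecture-24832`, h413 =
`stmt-HodgeConjecture-24833`) until rung 0 closes; count-neutral helper; (SC-an) is NOT ★ by this file (road «FC» still needs (FC-8) F1∕F2∕F3, (FC-9) and the U12 re-point).

## References
* [HarishChandra1970] Harish-Chandra (notes by G. van Dijk), *Harmonic Analysis on Reductive p-adic Groups*, LNM 162 (1970), Part VII §2 p. 69; Part VI §8 Thm 14 p. 60.
* [Rogawski1990] J. D. Rogawski, *Automorphic Representations of Unitary Groups in Three Variables*, Ann. of Math. Stud. 123 (1990), §1.10 p. 9 (`M = {d(α, β, ᾱ⁻¹)}`).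
-/

set_option autoImplicit false
set_option linter.dupNamespace false  -- the mandated namespace repeats the single-problem summit's segment (`HodgeConjecture.HodgeConjecture`)

noncomputable section

open MeasureTheory Set ValuativeRel Literature.NumberTheory.Automorphic Literature.NumberTheory.Automorphic.UnitaryGroup
open Literature.NumberTheory.GaloisRepresentations Literature.NumberTheory.GaloisRepresentations.IsNonarchimedeanLocalField
open Summit.HodgeConjecture.HodgeConjecture.Cruxes.H413.K2E3DiagonalCollisionMeasure Summit.HodgeConjecture.HodgeConjecture.Cruxes.H413.K2E3TorusOneAveraging
open scoped NNReal ENNReal MatrixGroups Pointwise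

namespace Summit.HodgeConjecture.HodgeConjecture.Cruxes.H413.K2E3TorusNearCollisionBound

variable {K : Type*} [Field K] [ValuativeRel K] [TopologicalSpace K] [IsNonarchimedeanLocalField K] [CharZero K]
  (σ : K →+* K) (hσ : ∀ x, σ (σ x) = x) (hσn : ∀ x, normAbs K (σ x) = normAbs K x)
  [MeasurableSpace Kˣ] [BorelSpace Kˣ] (μ' : Measure Kˣ) [μ'.IsHaarMeasure] [SFinite μ']
  [MeasurableSpace ↥(unitaryGroupOfForm σ ((StdForm.antidiagonal 3).over K))] [BorelSpace ↥(unitaryGroupOfForm σ ((StdForm.antidiagonal 3).over K))]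
  [SecondCountableTopology ↥(unitaryGroupOfForm σ ((StdForm.antidiagonal 3).over K))]
  (μ : Measure ↥(unitaryGroupOfForm σ ((StdForm.antidiagonal 3).over K))) [μ.IsMulLeftInvariant] [SFinite μ]

include hσn in
/-- **STEP (v), UN-CANCELLED, UNCONDITIONAL**: `∃ κ > 0, ∃ C ≠ ⊤, ∀ ρ > 0, ∀ ε, ∀ B` measurable, `𝒪^×`-torus invariant, with `ρ ≤ |g₀₀|, |g₁₁|` on `B`:
`μ'(𝒪^×) · μ(B ∩ NearColl_ε) ≤ C · (ε∕ρ)^κ · μ'(𝒪^×) · μ(B)` (★ (FC-5b) over ★ (FC-D)). [cite: HarishChandra1970, Part VII §2 p. 69] [cite: Rogawski1990, §1.10 p. 9] -/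
theorem unitSphere_mul_measure_inter_nearCollision_le :
    ∃ κ : ℝ, 0 < κ ∧ ∃ C : ℝ≥0∞, C ≠ ⊤ ∧ ∀ ρ : ℝ≥0, 0 < ρ → ∀ ε : ℝ≥0,
      ∀ B : Set ↥(unitaryGroupOfForm σ ((StdForm.antidiagonal 3).over K)), MeasurableSet B →
        (∀ a : Kˣ, valuation K (a : K) = 1 →
          (⟨glDiagonal 3 K ![a, 1, (Units.map (σ : K →* K) a)⁻¹], torusOne_mem_unitaryGroupOfForm σ hσ a⟩ :
            ↥(unitaryGroupOfForm σ ((StdForm.antidiagonal 3).over K))) • B = B) →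
        (∀ g ∈ B, ρ ≤ normAbs K (((g : GL (Fin 3) K) : Matrix (Fin 3) (Fin 3) K) 0 0) ∧ ρ ≤ normAbs K (((g : GL (Fin 3) K) : Matrix (Fin 3) (Fin 3) K) 1 1)) →
        μ' {a : Kˣ | valuation K (a : K) = 1} *
            μ (B ∩ {g | ∃ i j : Fin 3, i ≠ j ∧
              normAbs K (((g : GL (Fin 3) K) : Matrix (Fin 3) (Fin 3) K) i i - ((g : GL (Fin 3) K) : Matrix (Fin 3) (Fin 3) K) j j) ≤ ε}) ≤
          C * ((ε / ρ : ℝ≥0) : ℝ≥0∞) ^ κ * μ' {a : Kˣ | valuation K (a : K) = 1} * μ B :=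
  measure_inter_nearCollision_le_of_unitsDigitFibre σ hσ (K2E3UnitsDigitFibre.continuous_of_normAbs_eq σ hσn) hσn μ' μ
    (K2E3UnitsDigitFibre.unitsDigitFibre σ hσ hσn μ')

include μ' hσn in
/-- **STEP (v) OF ROAD «FC», UNCONDITIONAL** — the one-name discharge for (FC-8) F3: `∃ κ > 0, ∃ C ≠ ⊤, ∀ ρ > 0, ∀ ε, ∀ B ⊆ U(σ, Φ₃)(K)` measurable with `t_a • B = B`
(`a ∈ 𝒪^×`, `t_a = diag(a, 1, σ(a)⁻¹)`) and `ρ ≤ |g₀₀|, |g₁₁|` on `B`: **`μ(B ∩ {g | ∃ i ≠ j, |g_ii − g_jj| ≤ ε}) ≤ C · (ε∕ρ)^κ · μ(B)`** (`0 < μ'(𝒪^×) < ⊤` by ★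
`isOpen_units_valuation_eq_one` ∕ `isCompact_units_valuation_eq_one`). [cite: HarishChandra1970, Part VII §2 p. 69] [cite: Rogawski1990, §1.10 p. 9] -/
theorem measure_inter_nearCollision_le :
    ∃ κ : ℝ, 0 < κ ∧ ∃ C : ℝ≥0∞, C ≠ ⊤ ∧ ∀ ρ : ℝ≥0, 0 < ρ → ∀ ε : ℝ≥0,
      ∀ B : Set ↥(unitaryGroupOfForm σ ((StdForm.antidiagonal 3).over K)), MeasurableSet B →
        (∀ a : Kˣ, valuation K (a : K) = 1 →
          (⟨glDiagonal 3 K ![a, 1, (Units.map (σ : K →* K) a)⁻¹], torusOne_mem_unitaryGroupOfForm σ hσ a⟩ :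
            ↥(unitaryGroupOfForm σ ((StdForm.antidiagonal 3).over K))) • B = B) →
        (∀ g ∈ B, ρ ≤ normAbs K (((g : GL (Fin 3) K) : Matrix (Fin 3) (Fin 3) K) 0 0) ∧ ρ ≤ normAbs K (((g : GL (Fin 3) K) : Matrix (Fin 3) (Fin 3) K) 1 1)) →
        μ (B ∩ {g | ∃ i j : Fin 3, i ≠ j ∧
            normAbs K (((g : GL (Fin 3) K) : Matrix (Fin 3) (Fin 3) K) i i - ((g : GL (Fin 3) K) : Matrix (Fin 3) (Fin 3) K) j j) ≤ ε}) ≤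
          C * ((ε / ρ : ℝ≥0) : ℝ≥0∞) ^ κ * μ B :=
  measure_inter_nearCollision_le_of_unitsDigitFibre' σ hσ (K2E3UnitsDigitFibre.continuous_of_normAbs_eq σ hσn) hσn μ' μ
    ((isOpen_units_valuation_eq_one (F := K)).measure_pos μ' ⟨1, by simp⟩).ne'
    ((isCompact_units_valuation_eq_one (F := K)).measure_lt_top (μ := μ')).ne (K2E3UnitsDigitFibre.unitsDigitFibre σ hσ hσn μ')

end Summit.HodgeConjecture.HodgeConjecture.Cruxes.H413.K2E3TorusNearCollisionBound

end
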